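import Literature.AlgebraicGeometry.Resolution.KollarBlowupSequenceFunctors
import Literature.AlgebraicGeometry.Resolution.BlowupsProduct
import Literature.AlgebraicGeometry.Resolution.BlowupsFlatBaseChange
import HarnessLib

/-!
# Concatenation of blow-up sequences (Kollár 2007, 3.104 / 3.109–3.111: "continuing with …")

Topic: `Literature/AlgebraicGeometry/Resolution`. Shared infrastructure for the decomposition of
the named facts `Kollar2007Thm3_103` / `Kollar2007Thm3_107` (`KollarBlowupSequenceFunctors.lean`;
J. Kollár, *Lectures on Resolution of Singularities*, Ann. of Math. Stud. 166, 2007, Ch. 3), on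
the way to `Kollar2007MarkedOrderReduction` and `Hironaka1964`. Both inductive steps build their
blow-up sequence functors by CONCATENATION: one applies a functor, passes to the last blown-up
scheme `X_r` with the transformed ideal and boundary, and applies the next functor there
(3.104, Steps 1–3 of the proof of Thm. 3.103; 3.109/3.111, Steps 1–3 of the proof of Thm. 3.107:
"Continuing with `(X^1, (Π_1)_*^{-1}(I, m), (Π_1)_tot^{-1} E)`, we blow up …"). At the DATA level
of the tree's multiple blow-ups (`CentreSeq`, `BlowupSequences.lean`: the dependent list of the
successive centres, `cons` prepending the first blow-up) this is the concatenation
`s.append t` of a sequence `s` starting with `X` and a sequence `t` starting with the last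
scheme `s.top` of `s`. This file defines it and PROVES how every predicate and construction of
the tree behaves under it:

* `CentreSeq.append`, `nil_append`, `cons_append`, `append_nil`, `length_append`, `top_append`
  (the last scheme of `s.append t` is that of `t` — a propositional equality in general, `rfl`
  on constructors), `comp_append` (the composite is `t.comp ≫ s.comp`, through `eqToHom`);
* predicates: `allRegular_append_iff`, `noEmptyCentres_append_iff`, `centresOver_append_iff`,
  `isAdmissibleFor_append_iff`, `support_transformMarked_append_eq_empty_iff`,
  `isResolutionOf_append_iff` — **a concatenation resolves the marked ideal `M` iff the first
  part is a multiple blow-up of `M` and the second part resolves the transform of `M`**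
  (`transformMarked_append`: the transform along `s.append t` is the transform along `t` of the
  transform along `s`, as a heterogeneous equality over `top_append`);
* pull-backs (Kollár 3.30.1, `CentreSeq.comap` / `comapι` of `BlowupSequencesExtensions.lean`,
  `BlowupSequencesComapMarked.lean`): **`h^*(s ⧺ t) = h^*s ⧺ (h_r)^*t`** (`comap_append`), where
  `h_r = s.comapι h : (h^*s)_r → X_r` is the comparison morphism at the top;
* transport along equalities of sequences (`append_congr`, `eqToHom_comp_comp`), and the
  rigidity of blow-up towers used to compare comparison morphisms:
  `IsEffectiveCartier.comap_centreSeqComp` (an effective Cartier divisor on `X` pulls back to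
  an effective Cartier divisor on `X_r`, Stacks 0809 iterated: `IsEffectiveCartier.comap_of_isBlowup`)
  and **`CentreSeq.hom_ext_of_flat`: two morphisms `W ⟶ X_r` over `X`, one of them flat, are
  equal** (the universal property of each blow-up, `IsBlowup.hom_ext`, down the tower).

No smoothness or admissibility is assumed for the constructions; they enter only the predicate
lemmas. Nothing here is specific to Kollár's triples: the file is `CentreSeq` algebra.

## Sources

* J. Kollár, *Lectures on Resolution of Singularities* (2007): Def. 3.29–3.30 (blow-up sequences
  and their pull-backs), 3.104 and 3.109–3.111 (functors built by continuing on `X_r`). [Kollar2007]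
* E. Bierstone, D. Grigoriev, P. Milman, J. Włodarczyk, arXiv:1206.3090, Def. 3.1.3–3.1.5 — the
  tree's `CentreSeq` vocabulary. [BierstoneGrigorievMilmanWlodarczyk2011]
* U. Görtz, T. Wedhorn, *Algebraic Geometry I*, 2nd ed. (2020), Def. 13.90 (universal property of
  the blow-up). [GortzWedhorn2020]
* The Stacks Project, Tag 0809 (pull-back of effective Cartier divisors to a blow-up).
  [StacksProject]
-/

noncomputable section

open CategoryTheory CategoryTheory.Limits AlgebraicGeometry TopologicalSpace

namespace Literature.AlgebraicGeometry.Resolution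

universe u

namespace CentreSeq

variable {X U : Scheme.{u}}

/-! ## Concatenation -/

/-- **Concatenation of blow-up sequences**: `s.append t` performs the blow-ups of `s`
(`X_r → ⋯ → X_0 = X`) and then those of `t`, a sequence starting with the last scheme
`X_r = s.top` ("Continuing with `(X^1, …)`, we blow up …", Kollár 3.109).
[cite: Kollar2007, 3.109 (p. 176)] -/
def append : {X : Scheme.{u}} → (s : CentreSeq X) → CentreSeq s.top → CentreSeq X
  | _, nil _, t => t
  | _, cons C rest, t => cons C (append rest t)

/-- Unfolding. [folklore] -/
@[simp] theorem nil_append (t : CentreSeq X) : (nil X).append t = t := rfl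

/-- Unfolding. [folklore] -/
@[simp] theorem cons_append (C : X.IdealSheafData) (rest : CentreSeq (blowup C))
    (t : CentreSeq rest.top) : (cons C rest).append t = cons C (rest.append t) := rfl

/-- Appending the empty sequence. [folklore] -/
@[simp] theorem append_nil : ∀ {X : Scheme.{u}} (s : CentreSeq X), s.append (nil s.top) = s
  | _, nil _ => rfl
  | _, cons C rest => by rw [cons_append]; exact congrArg (cons C) (append_nil rest)

/-- The length of a concatenation. [folklore] -/
@[simp] theorem length_append : ∀ {X : Scheme.{u}} (s : CentreSeq X) (t : CentreSeq s.top),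
    (s.append t).length = s.length + t.length
  | _, nil _, t => by simp
  | _, cons C rest, t => by
    dsimp only [top_cons] at t ⊢
    rw [cons_append, length_cons, length_cons, length_append rest t]
    omega

/-- The last scheme of a concatenation is the last scheme of the second part. [folklore] -/
theorem top_append : ∀ {X : Scheme.{u}} (s : CentreSeq X) (t : CentreSeq s.top),
    (s.append t).top = t.top
  | _, nil _, _ => rfl
  | _, cons _ rest, t => top_append rest t

/-- The composite of a concatenation: `(s ⧺ t).comp = t.comp ≫ s.comp` (through the
identification `top_append`). [folklore] -/
theorem comp_append : ∀ {X : Scheme.{u}} (s : CentreSeq X) (t : CentreSeq s.top),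
    (s.append t).comp = eqToHom (top_append s t) ≫ t.comp ≫ s.comp
  | _, nil _, t => by simp
  | _, cons C rest, t => by
    dsimp only [top_cons] at t ⊢
    show (rest.append t).comp ≫ blowup.π C = _ ≫ t.comp ≫ rest.comp ≫ blowup.π C
    rw [comp_append rest t]
    simp only [Category.assoc]
    rfl

/-! ## Predicates under concatenation -/

/-- All centres of a concatenation are regular iff those of both parts are. [folklore] -/
theorem allRegular_append_iff : ∀ {X : Scheme.{u}} (s : CentreSeq X) (t : CentreSeq s.top),
    (s.append t).AllRegular ↔ s.AllRegular ∧ t.AllRegular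
  | _, nil _, t => by simp
  | _, cons C rest, t => by
    dsimp only [top_cons] at t ⊢
    rw [cons_append, allRegular_cons, allRegular_cons, allRegular_append_iff rest t, and_assoc]

/-- A concatenation has no empty blow-ups iff neither part has (Kollár's convention 3.32).
[cite: Kollar2007, 3.32 (p. 130)] -/
theorem noEmptyCentres_append_iff : ∀ {X : Scheme.{u}} (s : CentreSeq X) (t : CentreSeq s.top),
    (s.append t).NoEmptyCentres ↔ s.NoEmptyCentres ∧ t.NoEmptyCentres
  | _, nil _, t => by simp
  | _, cons C rest, t => by
    dsimp only [top_cons] at t ⊢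
    rw [cons_append, noEmptyCentres_cons, noEmptyCentres_cons, noEmptyCentres_append_iff rest t,
      and_assoc]

/-- The centres of a concatenation lie over `T` iff those of `s` do and those of `t` lie over
the preimage of `T` in `X_r`. [folklore] -/
theorem centresOver_append_iff : ∀ {X : Scheme.{u}} (s : CentreSeq X) (t : CentreSeq s.top)
    (T : Set X), (s.append t).CentresOver T ↔ s.CentresOver T ∧ t.CentresOver (s.comp ⁻¹' T)
  | _, nil _, _, _ => ⟨fun h => ⟨trivial, h⟩, fun h => h.2⟩
  | _, cons C rest, t, T => by
    dsimp only [top_cons] at t ⊢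
    rw [cons_append, centresOver_cons, centresOver_cons, centresOver_append_iff rest t, and_assoc]
    exact Iff.rfl

/-- **The transform along a concatenation** is the transform along `t` of the transform along
`s` (heterogeneous equality over `top_append`). [folklore] -/
theorem transformMarked_append : ∀ {X : Scheme.{u}} (s : CentreSeq X) (t : CentreSeq s.top)
    (M : MarkedIdeal X),
    HEq ((s.append t).transformMarked M) (t.transformMarked (s.transformMarked M))
  | _, nil _, _, _ => HEq.rfl
  | _, cons C rest, t, M => transformMarked_append rest t (M.transform (blowup.π C) C)

/-- **Admissibility of a concatenation**: `s ⧺ t` is a multiple blow-up of `M` iff `s` is one of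
`M` and `t` is one of the transform of `M` along `s`. [folklore] -/
theorem isAdmissibleFor_append_iff : ∀ {X : Scheme.{u}} (s : CentreSeq X) (t : CentreSeq s.top)
    (M : MarkedIdeal X),
    (s.append t).IsAdmissibleFor M ↔ s.IsAdmissibleFor M ∧ t.IsAdmissibleFor (s.transformMarked M)
  | _, nil _, t, M => by simp
  | _, cons C rest, t, M => by
    dsimp only [top_cons] at t ⊢
    rw [cons_append, isAdmissibleFor_cons, isAdmissibleFor_cons, isAdmissibleFor_append_iff rest t,
      transformMarked_cons]
    tauto

/-- The final support along a concatenation is empty iff the final support of the transform of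
`M` along `t ∘ s` is. [folklore] -/
theorem support_transformMarked_append_eq_empty_iff : ∀ {X : Scheme.{u}} (s : CentreSeq X)
    (t : CentreSeq s.top) (M : MarkedIdeal X),
    ((s.append t).transformMarked M).support = ∅ ↔
      (t.transformMarked (s.transformMarked M)).support = ∅
  | _, nil _, _, _ => Iff.rfl
  | _, cons _ rest, t, _ => support_transformMarked_append_eq_empty_iff rest t _

/-- **A concatenation resolves `M` iff its first part is a multiple blow-up of `M` and its second
part resolves the transform of `M`** — the shape of every "apply `𝓑₁`, then continue with `𝓑₂`
on `(X_r, I_r, E_r)`" argument (Kollár 3.104, 3.111). [cite: Kollar2007, 3.111 (p. 176)] -/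
theorem isResolutionOf_append_iff (s : CentreSeq X) (t : CentreSeq s.top) (M : MarkedIdeal X) :
    (s.append t).IsResolutionOf M ↔ s.IsAdmissibleFor M ∧ t.IsResolutionOf (s.transformMarked M) := by
  rw [IsResolutionOf, IsResolutionOf, isAdmissibleFor_append_iff,
    support_transformMarked_append_eq_empty_iff, and_assoc]

/-- Continuing a multiple blow-up of `M` by a resolution of its transform resolves `M`.
[cite: Kollar2007, 3.111 (p. 176)] -/
theorem IsAdmissibleFor.append {s : CentreSeq X} {M : MarkedIdeal X} (hs : s.IsAdmissibleFor M)
    {t : CentreSeq s.top} (ht : t.IsResolutionOf (s.transformMarked M)) :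
    (s.append t).IsResolutionOf M :=
  (isResolutionOf_append_iff s t M).mpr ⟨hs, ht⟩

/-! ## Pull-backs of concatenations -/

/-- **`h^*(s ⧺ t) = h^*s ⧺ (h_r)^*t`**: the sequence induced from a concatenation along
`f : U ⟶ X` is the induced sequence of `s` followed by the sequence induced from `t` along the
comparison morphism `s.comapι f : (f^*s)_r ⟶ X_r` (Kollár 3.30.1: the pull-back is taken stage
by stage, `X_i ×_X Y`). [cite: Kollar2007, Def. 3.30.1 (p. 128)] -/
theorem comap_append : ∀ {X U : Scheme.{u}} (s : CentreSeq X) (t : CentreSeq s.top) (f : U ⟶ X),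
    (s.append t).comap f = (s.comap f).append (t.comap (s.comapι f))
  | _, _, nil _, _, _ => rfl
  | _, _, cons C rest, t, f =>
    congrArg (cons (C.comap f)) (comap_append rest t (blowup.comapMap C f))

/-- Along an open immersion: the restriction of a concatenation. [folklore] -/
theorem restrict_append (s : CentreSeq X) (t : CentreSeq s.top) (j : U ⟶ X) [IsOpenImmersion j] :
    (s.append t).restrict j = (s.comap j).append (t.comap (s.comapι j)) := by
  rw [restrict_eq_comap, comap_append]

/-! ## Transport along equalities of sequences -/

/-- Transport of the second part of a concatenation along an equality of first parts.
[folklore] -/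
theorem append_congr {s₁ s₂ : CentreSeq X} (e : s₁ = s₂) (t : CentreSeq s₂.top) :
    s₁.append (t.comap (eqToHom (congrArg top e))) = s₂.append t := by
  subst e
  simp

/-- Transport of the composite along an equality of sequences. [folklore] -/
@[simp] theorem eqToHom_comp_comp {s₁ s₂ : CentreSeq X} (e : s₁ = s₂) :
    eqToHom (congrArg top e) ≫ s₂.comp = s₁.comp := by
  subst e
  simp

/-- Pulling back along `eqToHom e` and back again. [folklore] -/
theorem comap_eqToHom_comap_eqToHom_symm {Y Z : Scheme.{u}} (e : Y = Z) (t : CentreSeq Y) :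
    (t.comap (eqToHom e.symm)).comap (eqToHom e) = t := by
  subst e
  simp

/-! ## Rigidity of blow-up towers -/

/-- **An effective Cartier divisor on `X` pulls back to an effective Cartier divisor on the top
`X_r` of any blow-up sequence** (Stacks 0809 for each blow-up,
`IsEffectiveCartier.comap_of_isBlowup`). [cite: StacksProject, Tag 0809] -/
theorem _root_.Literature.AlgebraicGeometry.Resolution.IsEffectiveCartier.comap_centreSeqComp :
    ∀ {X : Scheme.{u}} (s : CentreSeq X) {D : X.IdealSheafData},
      IsEffectiveCartier D → IsEffectiveCartier (D.comap s.comp)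
  | _, nil _, D, hD => by simpa using hD
  | _, cons C rest, D, hD => by
    show IsEffectiveCartier (D.comap (rest.comp ≫ blowup.π C))
    rw [Scheme.IdealSheafData.comap_comp]
    exact (hD.comap_of_isBlowup (blowup.isBlowup C)).comap_centreSeqComp rest

/-- **Rigidity of blow-up towers**: two morphisms `φ₁, φ₂ : W ⟶ X_r` into the top of a blow-up
sequence which agree over `X`, with `φ₁` flat, are equal — by the universal property of each
blow-up down the tower (`IsBlowup.hom_ext`), the exceptional divisors pulling back to effective
Cartier divisors on `X_r` (`IsEffectiveCartier.comap_centreSeqComp`) and along the flat `φ₁`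
(`IsEffectiveCartier.comap_of_flat`). In particular comparison morphisms between tops of
blow-up sequences (isomorphisms, flat base changes) are determined by what they do over `X`.
[cite: GortzWedhorn2020, Def. 13.90] -/
theorem hom_ext_of_flat : ∀ {X : Scheme.{u}} (s : CentreSeq X) {W : Scheme.{u}}
    {φ₁ φ₂ : W ⟶ s.top} [Flat φ₁], φ₁ ≫ s.comp = φ₂ ≫ s.comp → φ₁ = φ₂
  | _, nil _, _, φ₁, φ₂, _, h => by simpa using h
  | _, cons C rest, W, φ₁, φ₂, hφ, h => by
    -- retype the morphisms at `rest.top` (`(cons C rest).top` is `rest.top` by `rfl`)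
    change W ⟶ rest.top at φ₁ φ₂
    change Flat φ₁ at hφ
    have h' : (φ₁ ≫ rest.comp) ≫ blowup.π C = (φ₂ ≫ rest.comp) ≫ blowup.π C := by
      simp only [Category.assoc]
      exact h
    have hcart : IsEffectiveCartier (C.comap ((φ₁ ≫ rest.comp) ≫ blowup.π C)) := by
      rw [Scheme.IdealSheafData.comap_comp, Scheme.IdealSheafData.comap_comp]
      exact (((blowup.isBlowup C).isEffectiveCartier).comap_centreSeqComp rest).comap_of_flat φ₁
    exact hom_ext_of_flat rest ((blowup.isBlowup C).hom_ext hcart h')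

/-- A flat endomorphism of the top of a blow-up sequence over `X` is the identity. [folklore] -/
theorem eq_id_of_comp_eq (s : CentreSeq X) {φ : s.top ⟶ s.top} [Flat φ] (h : φ ≫ s.comp = s.comp) :
    φ = 𝟙 s.top :=
  s.hom_ext_of_flat (by simpa using h)

end CentreSeq

end Literature.AlgebraicGeometry.Resolution

end
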